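import Mathlib
import Summits.Ventures.PercRepro.TriangleCapSevenElevenC

/-!
# PercRepro — towards the cell `(7, 11)`: the two-triangle case is a theorem (p3, gen 35; part 35j)

* `stability_of_triangle_bounds_seven` — at `k = 7`, `|T₃| ≥ 12` and `2·Σ_{T₃}|outer| + 3·Σ_{codeg=0} deficit ≥ 18`
  give `Σ_v d(v)² + 5 ≤ 7m`;
* `two_le_sum_codeg_zero` — one far `codeg = 0` pair gives `Σ₀ ≥ 2`;
* `outer_case_seven` — a triangle with an outer vertex: `2·Σ|outer| + 3·Σ₀ ≥ 18` (the outer vertex off `S`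
  gives `24` by `outer_bound`; an outer vertex of the first triangle inside the second makes the triangles
  vertex-disjoint, and a vertex off `S` is then outer itself or gives a far pair `(r, t₁)`);
* `bowtie_core` — triangles sharing a vertex, no outer vertex, `m ≥ 2k − 3`: `Σ₀ ≥ 6` (a two-sided vertex off
  `S` by `six_le_of_bowtie_two_nbrs`, else every vertex off `S` hangs on the shared vertex and `m ≤ k + 1`);
* **`stability_two_triangles_seven`** — a `K₄⁻`-free graph on `7` vertices with `m ≥ 11` edges and two
  triangles `u v w`, `a b c` (`a ∉ {u, v, w}`) whose every triangle vertex lies in `S = {u, v, w, a, b, c}` has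
  `Σ_v d(v)² + 5 ≤ 7m`.  With `one_triangle_stability_seven` and `mantel_stability`, what remains of the cell
  `(7, 11)` is the case of a third triangle with a vertex off `S`.

Axioms: standard.
-/

namespace PercRepro

namespace TriangleCap

namespace C047

open Finset

variable {V : Type*} [Fintype V] [DecidableEq V]

/-- **THE CHAIN AT `k = 7`:** `|T₃| ≥ 12` and `2·Σ_{T₃}|outer| + 3·Σ_{codeg = 0} deficit ≥ 18` give
`Σ_v d(v)² + 5 ≤ 7m`. -/
theorem stability_of_triangle_bounds_seven (D : SimpleGraph V) [DecidableRel D.Adj] (hK : K4mFree D)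
    (hk : Fintype.card V = 7) (hT : 12 ≤ (triangles3 D).card)
    (h : 18 ≤ 2 * ∑ t ∈ triangles3 D, (outer D t.1.1 t.1.2 t.2).card +
      3 * ∑ p ∈ adjPairsAll D, (if codeg D p = 0 then deficit D p else 0)) :
    ∑ v, deg D v * deg D v + (Fintype.card V - 2) ≤ D.edgeFinset.card * Fintype.card V := by
  have hid := two_mul_sum_deg_sq_add_sum_deficit D
  have hsplit := sum_deficit_split D hK
  have hrot := card_mul_add_two_mul_sum_outer_le D hK
  rw [hk] at hrot hid ⊢
  rw [hsplit] at hid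
  generalize hS : ∑ v, deg D v * deg D v = S at hid ⊢
  generalize hA : ∑ t ∈ triangles3 D, deficit D t.1 = A at hid hrot
  generalize hB : ∑ p ∈ adjPairsAll D, (if codeg D p = 0 then deficit D p else 0) = B at hid h
  generalize hQ : ∑ t ∈ triangles3 D, (outer D t.1.1 t.1.2 t.2).card = Q at hrot h
  generalize hTT : (triangles3 D).card = T at hid hrot hT
  generalize hM : D.edgeFinset.card = M at hid ⊢
  omega

/-- One far `codeg = 0` pair gives `Σ_{codeg = 0} deficit ≥ 2`. -/
theorem two_le_sum_codeg_zero (D : SimpleGraph V) [DecidableRel D.Adj] {x t : V} (hxt : D.Adj x t)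
    (hc : codeg D (x, t) = 0) (hd : 1 ≤ deficit D (x, t)) :
    2 ≤ ∑ p ∈ adjPairsAll D, (if codeg D p = 0 then deficit D p else 0) := by
  set P : Finset (V × V) := {(x, t), (t, x)} with hP
  have hsub : P ⊆ adjPairsAll D := by
    intro p hp
    rw [hP] at hp
    simp only [mem_insert, mem_singleton] at hp
    rw [mem_adjPairsAll]
    rcases hp with rfl | rfl
    · exact hxt
    · exact hxt.symm
  have hc' : codeg D (t, x) = 0 := by rw [codeg_comm]; exact hc
  have hd' : 1 ≤ deficit D (t, x) := by rw [deficit_comm]; exact hd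
  have hpos : ∀ p ∈ P, 1 ≤ (if codeg D p = 0 then deficit D p else 0) := by
    intro p hp
    rw [hP] at hp
    simp only [mem_insert, mem_singleton] at hp
    rcases hp with rfl | rfl
    · rw [if_pos hc]; exact hd
    · rw [if_pos hc']; exact hd'
  have hcard : P.card = 2 := by
    rw [hP, card_insert_of_notMem, card_singleton]
    simp [hxt.ne]
  calc 2 = ∑ _p ∈ P, 1 := by rw [sum_const, hcard]; rfl
    _ ≤ ∑ p ∈ P, (if codeg D p = 0 then deficit D p else 0) := sum_le_sum hpos
    _ ≤ ∑ p ∈ adjPairsAll D, (if codeg D p = 0 then deficit D p else 0) := sum_le_sum_of_subset hsub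

/-- **A TRIANGLE WITH AN OUTER VERTEX (`k ≥ 7`):** `2·Σ_{T₃}|outer| + 3·Σ_{codeg = 0} deficit ≥ 18`, stated
for an outer vertex of the first triangle. -/
theorem outer_case_seven (D : SimpleGraph V) [DecidableRel D.Adj] (hK : K4mFree D) (hk : 7 ≤ Fintype.card V)
    {u v w a b c x : V} (huv : D.Adj u v) (huw : D.Adj u w) (hvw : D.Adj v w) (hab : D.Adj a b)
    (hac : D.Adj a c) (hbc : D.Adj b c) (ha : ¬ (a = u ∨ a = v ∨ a = w))
    (hS : ∀ x y z, D.Adj x y → D.Adj x z → D.Adj y z → x = u ∨ x = v ∨ x = w ∨ x = a ∨ x = b ∨ x = c)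
    (hx : x ∈ outer D u v w) :
    18 ≤ 2 * ∑ t ∈ triangles3 D, (outer D t.1.1 t.1.2 t.2).card +
      3 * ∑ p ∈ adjPairsAll D, (if codeg D p = 0 then deficit D p else 0) := by
  have h6 := six_le_sum_outer D huv huw hvw hx
  have hx' := (mem_outer D u v w x).mp hx
  have hxT1 : ¬ (x = u ∨ x = v ∨ x = w) := by
    rintro (h | h | h)
    · subst h; exact hx'.2.1 huv.symm
    · subst h; exact hx'.1 huv
    · subst h; exact hx'.1 huw
  -- two distinct vertices of the second triangle are adjacent
  have hadjT2 : ∀ y z, (y = a ∨ y = b ∨ y = c) → (z = a ∨ z = b ∨ z = c) → y ≠ z → D.Adj y z := by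
    rintro y z (rfl | rfl | rfl) (rfl | rfl | rfl) hne
    · exact (hne rfl).elim
    · exact hab
    · exact hac
    · exact hab.symm
    · exact (hne rfl).elim
    · exact hbc
    · exact hac.symm
    · exact hbc.symm
    · exact (hne rfl).elim
  by_cases hxS : x = u ∨ x = v ∨ x = w ∨ x = a ∨ x = b ∨ x = c
  · -- `x ∈ S`: `x` is a vertex of the second triangle, adjacent to none of the first
    have hxT2 : x = a ∨ x = b ∨ x = c := or3_of_or6_right hxS hxT1
    -- a vertex of the first triangle is not in the second (else adjacent to `x`)
    have hT1T2 : ∀ t, (t = u ∨ t = v ∨ t = w) → ¬ (t = a ∨ t = b ∨ t = c) := by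
      intro t ht ht2
      have hne : x ≠ t := fun h => hxT1 (h ▸ ht)
      have hadj : D.Adj x t := hadjT2 x t hxT2 ht2 hne
      rcases ht with rfl | rfl | rfl
      · exact hx'.1 hadj.symm
      · exact hx'.2.1 hadj.symm
      · exact hx'.2.2 hadj.symm
    obtain ⟨r, hr⟩ := exists_not_six hk u v w a b c
    have hr1 : ¬ (r = u ∨ r = v ∨ r = w) := fun h => hr (or6_of_or3_left h)
    have hr2 : ¬ (r = a ∨ r = b ∨ r = c) := fun h => hr (or6_of_or3_right h)
    by_cases hrO : r ∈ outer D u v w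
    · exact le_trans (by norm_num) (outer_bound D hK huv huw hvw hab hac hbc ha hS hrO hr)
    · have hno : ∀ y z, D.Adj r y → D.Adj r z → D.Adj y z → False :=
        fun y z h1 h2 h3 => hr (hS r y z h1 h2 h3)
      obtain ⟨t₁, ht₁, hrt₁⟩ : ∃ t₁, (t₁ = u ∨ t₁ = v ∨ t₁ = w) ∧ D.Adj r t₁ := by
        rcases adj_of_not_outer D hrO with h | h | h
        · exact ⟨u, by simp, h.symm⟩
        · exact ⟨v, by simp, h.symm⟩
        · exact ⟨w, by simp, h.symm⟩
      have hc : codeg D (r, t₁) = 0 := codeg_eq_zero_of_no_triangle D hrt₁ hno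
      obtain ⟨z, hz1, hz2⟩ := exists_nonadj_of_triangle D hK hab hac hbc hr2 (hT1T2 t₁ ht₁)
      have h2 := two_le_sum_codeg_zero D hrt₁ hc (one_le_deficit D hz1 hz2)
      omega
  · exact le_trans (by norm_num) (outer_bound D hK huv huw hvw hab hac hbc ha hS hx hxS)

/-- **THE BOWTIE CORE:** triangles `u v w`, `u b c`, no outer vertex, `m ≥ 2k − 3`, `k ≥ 7`: `Σ₀ ≥ 6`. -/
theorem bowtie_core (D : SimpleGraph V) [DecidableRel D.Adj] (hK : K4mFree D) (hk : 7 ≤ Fintype.card V)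
    (hm : 2 * Fintype.card V ≤ D.edgeFinset.card + 3) {u v w b c : V}
    (huv : D.Adj u v) (huw : D.Adj u w) (hvw : D.Adj v w) (hub : D.Adj u b) (huc : D.Adj u c)
    (hbc : D.Adj b c) (hvb : v ≠ b) (hvc : v ≠ c) (hwb : w ≠ b) (hwc : w ≠ c)
    (hS : ∀ x y z, D.Adj x y → D.Adj x z → D.Adj y z → x = u ∨ x = v ∨ x = w ∨ x = b ∨ x = c)
    (hO1 : outer D u v w = ∅) (hO2 : outer D u b c = ∅) :
    6 ≤ ∑ p ∈ adjPairsAll D, (if codeg D p = 0 then deficit D p else 0) := by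
  by_cases hex : ∃ r, ¬ (r = u ∨ r = v ∨ r = w ∨ r = b ∨ r = c) ∧ ∃ y₁ y₂,
      (y₁ = u ∨ y₁ = v ∨ y₁ = w ∨ y₁ = b ∨ y₁ = c) ∧ (y₂ = u ∨ y₂ = v ∨ y₂ = w ∨ y₂ = b ∨ y₂ = c) ∧
      y₁ ≠ y₂ ∧ D.Adj r y₁ ∧ D.Adj r y₂
  · obtain ⟨r, hr, y₁, y₂, hy₁, hy₂, h12, hry₁, hry₂⟩ := hex
    exact six_le_of_bowtie_two_nbrs D hK hk huv huw hvw hub huc hbc hvb hvc hwb hwc hS hO1 hO2 hr hy₁ hy₂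
      h12 hry₁ hry₂
  · exfalso
    have hno : ∀ r, ¬ (r = u ∨ r = v ∨ r = w ∨ r = b ∨ r = c) → ∀ y₁ y₂,
        (y₁ = u ∨ y₁ = v ∨ y₁ = w ∨ y₁ = b ∨ y₁ = c) → (y₂ = u ∨ y₂ = v ∨ y₂ = w ∨ y₂ = b ∨ y₂ = c) →
        D.Adj r y₁ → D.Adj r y₂ → y₁ = y₂ := by
      intro r hr y₁ y₂ hy₁ hy₂ h1 h2
      by_contra hne
      exact hex ⟨r, hr, y₁, y₂, hy₁, hy₂, hne, h1, h2⟩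
    have := card_edges_le_of_hang D hK huv huw hvw hub huc hbc hvb hvc hwb hwc hS hO1 hO2 hno
    omega

/-- **THE TWO-TRIANGLE CASE AT `(7, 11)`:** a `K₄⁻`-free graph on `7` vertices with `m ≥ 11` edges, two
triangles `u v w`, `a b c` (`a ∉ {u, v, w}`) and every triangle vertex in `S = {u, v, w, a, b, c}` has
`Σ_v d(v)² + 5 ≤ 7m`. -/
theorem stability_two_triangles_seven (D : SimpleGraph V) [DecidableRel D.Adj] (hK : K4mFree D)
    (hk : Fintype.card V = 7) (hm : 2 * Fintype.card V ≤ D.edgeFinset.card + 3) {u v w a b c : V}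
    (huv : D.Adj u v) (huw : D.Adj u w) (hvw : D.Adj v w) (hab : D.Adj a b) (hac : D.Adj a c)
    (hbc : D.Adj b c) (ha : ¬ (a = u ∨ a = v ∨ a = w))
    (hS : ∀ x y z, D.Adj x y → D.Adj x z → D.Adj y z → x = u ∨ x = v ∨ x = w ∨ x = a ∨ x = b ∨ x = c) :
    ∑ v, deg D v * deg D v + (Fintype.card V - 2) ≤ D.edgeFinset.card * Fintype.card V := by
  have h12 := twelve_le_card_triangles3 D huv huw hvw hab hac hbc ha
  have hk7 : 7 ≤ Fintype.card V := by omega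
  have hau : a ≠ u := fun h => ha (Or.inl h)
  have hav : a ≠ v := fun h => ha (Or.inr (Or.inl h))
  have haw : a ≠ w := fun h => ha (Or.inr (Or.inr h))
  apply stability_of_triangle_bounds_seven D hK hk h12
  by_cases hO1 : outer D u v w = ∅
  · by_cases hO2 : outer D a b c = ∅
    · -- no outer vertex for either triangle: `Σ₀ ≥ 6`
      suffices h6 : 6 ≤ ∑ p ∈ adjPairsAll D, (if codeg D p = 0 then deficit D p else 0) by omega
      by_cases hsh : ∃ y, (y = u ∨ y = v ∨ y = w) ∧ (y = a ∨ y = b ∨ y = c)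
      · -- the bowtie: the shared vertex
        obtain ⟨y, hy1, hy2⟩ := hsh
        rcases hy1 with h1 | h1 | h1 <;> rcases hy2 with h2 | h2 | h2
        · exact (ha (by rw [← h2, h1]; simp)).elim
        · cases h1.symm; cases h2
          have hvc : v ≠ c := fun h => by
            subst h; exact not_adj_both D hK huv huw hvw haw.symm hab.symm hac.symm
          have hwc : w ≠ c := fun h => by
            subst h; exact not_adj_both D hK huw huv hvw.symm hav.symm hab.symm hac.symm
          refine bowtie_core D hK hk7 hm huv huw hvw hab.symm hbc hac hav.symm hvc haw.symm hwc ?_ hO1 ?_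
          · intro x y z h1 h2 h3
            rcases hS x y z h1 h2 h3 with h | h | h | h | h | h <;> simp [h]
          · rw [← outer_comm₁]; exact hO2
        · cases h1.symm; cases h2
          have hvb : v ≠ b := fun h => by
            subst h; exact not_adj_both D hK huv huw hvw haw.symm hac.symm hab.symm
          have hwb : w ≠ b := fun h => by
            subst h; exact not_adj_both D hK huw huv hvw.symm hav.symm hac.symm hab.symm
          refine bowtie_core D hK hk7 hm huv huw hvw hac.symm hbc.symm hab hav.symm hvb haw.symm hwb ?_ hO1 ?_
          · intro x y z h1 h2 h3
            rcases hS x y z h1 h2 h3 with h | h | h | h | h | h <;> simp [h]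
          · rw [← outer_comm₂]; exact hO2
        · exact (ha (by rw [← h2, h1]; simp)).elim
        · cases h1.symm; cases h2
          have huc : u ≠ c := fun h => by
            subst h; exact not_adj_both D hK huv.symm hvw huw haw.symm hab.symm hac.symm
          have hwc : w ≠ c := fun h => by
            subst h; exact not_adj_both D hK hvw huv.symm huw.symm hau.symm hab.symm hac.symm
          refine bowtie_core D hK hk7 hm huv.symm hvw huw hab.symm hbc hac hau.symm huc haw.symm hwc ?_ ?_ ?_
          · intro x y z h1 h2 h3
            rcases hS x y z h1 h2 h3 with h | h | h | h | h | h <;> simp [h]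
          · rw [← outer_comm₁]; exact hO1
          · rw [← outer_comm₁]; exact hO2
        · cases h1.symm; cases h2
          have hub : u ≠ b := fun h => by
            subst h; exact not_adj_both D hK huv.symm hvw huw haw.symm hac.symm hab.symm
          have hwb : w ≠ b := fun h => by
            subst h; exact not_adj_both D hK hvw huv.symm huw.symm hau.symm hac.symm hab.symm
          refine bowtie_core D hK hk7 hm huv.symm hvw huw hac.symm hbc.symm hab hau.symm hub haw.symm hwb
            ?_ ?_ ?_
          · intro x y z h1 h2 h3
            rcases hS x y z h1 h2 h3 with h | h | h | h | h | h <;> simp [h]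
          · rw [← outer_comm₁]; exact hO1
          · rw [← outer_comm₂]; exact hO2
        · exact (ha (by rw [← h2, h1]; simp)).elim
        · cases h1.symm; cases h2
          have huc : u ≠ c := fun h => by
            subst h; exact not_adj_both D hK huw.symm hvw.symm huv hav.symm hab.symm hac.symm
          have hvc : v ≠ c := fun h => by
            subst h; exact not_adj_both D hK hvw.symm huw.symm huv.symm hau.symm hab.symm hac.symm
          refine bowtie_core D hK hk7 hm huw.symm hvw.symm huv hab.symm hbc hac hau.symm huc hav.symm hvc
            ?_ ?_ ?_
          · intro x y z h1 h2 h3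
            rcases hS x y z h1 h2 h3 with h | h | h | h | h | h <;> simp [h]
          · rw [← outer_comm₂]; exact hO1
          · rw [← outer_comm₁]; exact hO2
        · cases h1.symm; cases h2
          have hub : u ≠ b := fun h => by
            subst h; exact not_adj_both D hK huw.symm hvw.symm huv hav.symm hac.symm hab.symm
          have hvb : v ≠ b := fun h => by
            subst h; exact not_adj_both D hK hvw.symm huw.symm huv.symm hau.symm hac.symm hab.symm
          refine bowtie_core D hK hk7 hm huw.symm hvw.symm huv hac.symm hbc.symm hab hau.symm hub hav.symm hvb
            ?_ ?_ ?_
          · intro x y z h1 h2 h3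
            rcases hS x y z h1 h2 h3 with h | h | h | h | h | h <;> simp [h]
          · rw [← outer_comm₂]; exact hO1
          · rw [← outer_comm₂]; exact hO2
      · -- vertex-disjoint
        have hb : ¬ (b = u ∨ b = v ∨ b = w) := fun h => hsh ⟨b, h, by simp⟩
        have hc : ¬ (c = u ∨ c = v ∨ c = w) := fun h => hsh ⟨c, h, by simp⟩
        exact six_le_of_disjoint_no_outer D hK hk7 huv huw hvw hab hac hbc ha hb hc hS hO1 hO2
    · -- an outer vertex of the second triangle: swap the triangles
      obtain ⟨x, hx⟩ := nonempty_iff_ne_empty.mpr hO2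
      by_cases hu2 : u = a ∨ u = b ∨ u = c
      · -- `u` is the shared vertex, so `v` is not in the second triangle
        have hv2 : ¬ (v = a ∨ v = b ∨ v = c) := by
          rintro (h | h | h)
          · exact hav h.symm
          · rcases hu2 with h' | h' | h'
            · exact hau h'.symm
            · exact huv.ne (h'.trans h.symm)
            · subst h; subst h'; exact not_adj_both D hK huv huw hvw haw.symm hac.symm hab.symm
          · rcases hu2 with h' | h' | h'
            · exact hau h'.symm
            · subst h; subst h'; exact not_adj_both D hK huv huw hvw haw.symm hab.symm hac.symm
            · exact huv.ne (h'.trans h.symm)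
        refine outer_case_seven D hK hk7 hab hac hbc huv.symm hvw huw hv2 ?_ hx
        intro x y z h1 h2 h3
        rcases hS x y z h1 h2 h3 with h | h | h | h | h | h <;> simp [h]
      · refine outer_case_seven D hK hk7 hab hac hbc huv huw hvw hu2 ?_ hx
        intro x y z h1 h2 h3
        rcases hS x y z h1 h2 h3 with h | h | h | h | h | h <;> simp [h]
  · obtain ⟨x, hx⟩ := nonempty_iff_ne_empty.mpr hO1
    exact outer_case_seven D hK hk7 huv huw hvw hab hac hbc ha hS hx

end C047

end TriangleCap

end PercRepro
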